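import Literature.NumberTheory.Transcendental.KZCalculus

/-!
# `NormalFormPrinciple` (stmt-KontsevichZagierPeriods-3869), line `SketchIdeator1` —
# sharp one-move form of the unit-box normalisation of bounded volumes (siege attempt k6)

Pure proof file (`--supports` the crux stmt-KontsevichZagierPeriods-3869), one theorem:
**a bounded volume `[A, 1]` differs by a SINGLE change-of-variables generator from a
representation inside the OPEN unit box `(0,1)ᵈ` with the constant integrand `Tᵈ`, `T ≥ 1` an
integer** — `[A] − [B] ∈ changeOfVariablesRel`, strictly sharper than the `∈ relations` form of the
unit-box normalisation used by the line (`PiBox.exists_unitBox_model`, three moves: integer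
translation, linear scaling, removal of the null faces `yᵢ = 0`, hence rules (2) and (1a)). The
sharp form records that this step of the `PiBoxReduction` engine costs rule (2) ALONE — no
additivity, no Newton–Leibniz — which is the grain at which the crux's rule-class bookkeeping
(`Cruxes/NormalFormPrinciple/Disproof.lean`, the `…_false_without_…` theorems) is kept.

The certificate is the explicit affine chart of [Kontsevich–Zagier 2001, §1.2], rule (2),

  `Φ(x) = T⁻¹ • (x + K·𝟙)`,  `K := ⌈C⌉₊ + 1`,  `T := 2K`,

where `C` bounds `‖x‖` on the domain `σ` of `A`. Since `|xᵢ| ≤ C < K` on `σ`, the chart maps `σ`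
STRICTLY inside the open box (no closed face is touched, so no null set has to be discarded), it is
a polynomial map with rational coefficients (hence `ℚ`-semialgebraic, and so is the image
`Φ(σ) = Ψ⁻¹(σ)`, `Ψ(y) = T • y − K·𝟙`, as a polynomial preimage — no Tarski–Seidenberg), it is
injective with constant derivative `T⁻¹ • id` of determinant `T⁻ᵈ`, and the Jacobian identity
reads `1 = Tᵈ · |T⁻ᵈ|`. Hence `[A] − [Φ(σ), Tᵈ] ∈ changeOfVariablesRel`.
No definitions are introduced. Sources: M. Kontsevich, D. Zagier, *Periods* (2001), §1.2, rule (2).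
-/

noncomputable section

open MeasureTheory Set MvPolynomial
open Literature.NumberTheory.Transcendental Literature.NumberTheory.Transcendental.KZ
open Literature.ModelTheory.ExponentialFields (IsSemialgebraic)

namespace Summit.KontsevichZagierPeriods.HurwitzMicroSectors.NormalFormPrinciple.PiBox

namespace UnitBoxSiegeK6

/-- **Sharp one-move unit-box normalisation of a bounded volume.** A representation with
integrand `1` on a bounded domain differs by a SINGLE change-of-variables generator (rule (2), the
affine chart `Φ(x) = T⁻¹ • (x + K·𝟙)`, `K = ⌈C⌉₊ + 1`, `T = 2K`) from a representation with
domain inside the open unit box `(0,1)ᵈ` and constant integrand `Tᵈ`, for some integer `T ≥ 1`: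
`[A] − [B] ∈ changeOfVariablesRel` (in particular `∈ relations`, by
`changeOfVariablesRel_subset_relations`). [cite: KontsevichZagier2001, §1.2 rule (2)] -/
theorem exists_unitBox_model_mem_changeOfVariablesRel {d : ℕ} (A : IntegralRep d)
    (hb : Bornology.IsBounded A.domain) (h1 : ∀ z ∈ A.domain, A.integrand z = 1) :
    ∃ (T : ℕ) (B : IntegralRep d), 1 ≤ T ∧ B.domain ⊆ {y | ∀ i, y i ∈ Set.Ioo (0:ℝ) 1} ∧
      (B.integrand = fun _ => (T : ℝ) ^ d) ∧ of A - of B ∈ changeOfVariablesRel := by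
  -- Step 0: an integer `K` with `|xᵢ| < K` on the domain, and `T := 2K`.
  obtain ⟨C, hC⟩ := (Metric.isBounded_iff_subset_closedBall 0).1 hb
  set K : ℕ := ⌈C⌉₊ + 1 with hK
  have hCK : C < K := by
    rw [hK, Nat.cast_add, Nat.cast_one]
    exact lt_of_le_of_lt (Nat.le_ceil C) (lt_add_one _)
  have hcoord : ∀ x ∈ A.domain, ∀ i, -(K : ℝ) < x i ∧ x i < K := by
    intro x hx i
    have hxC : ‖x‖ ≤ C := mem_closedBall_zero_iff.1 (hC hx)
    have hxi : |x i| ≤ C := by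
      rw [← Real.norm_eq_abs]
      exact (norm_le_pi_norm x i).trans hxC
    exact abs_lt.1 (lt_of_le_of_lt hxi hCK)
  set T : ℕ := 2 * K with hT
  have hK1 : (1 : ℝ) ≤ K := by
    rw [hK, Nat.cast_add, Nat.cast_one]
    linarith [(Nat.cast_nonneg (⌈C⌉₊) : (0 : ℝ) ≤ ⌈C⌉₊)]
  have hTK : (T : ℝ) = 2 * K := by rw [hT]; push_cast; ring
  have hTpos : (0 : ℝ) < T := by rw [hTK]; linarith
  have hTne : (T : ℝ) ≠ 0 := hTpos.ne'
  -- Step 1: the chart, its inverse, its derivative.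
  let v : Fin d → ℝ := fun _ => (K : ℝ)
  let Φ : (Fin d → ℝ) → (Fin d → ℝ) := fun x => (T : ℝ)⁻¹ • (x + v)
  let Ψ : (Fin d → ℝ) → (Fin d → ℝ) := fun y => (T : ℝ) • y - v
  let L : (Fin d → ℝ) →L[ℝ] (Fin d → ℝ) := (T : ℝ)⁻¹ • ContinuousLinearMap.id ℝ _
  have hΦ : ∀ x i, Φ x i = (T : ℝ)⁻¹ * (x i + K) := fun x i => rfl
  have hΨ : ∀ y i, Ψ y i = (T : ℝ) * y i - K := fun y i => rfl
  have hΨΦ : ∀ x, Ψ (Φ x) = x := by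
    intro x; ext i
    rw [hΨ, hΦ, ← mul_assoc, mul_inv_cancel₀ hTne, one_mul, add_sub_cancel_right]
  have hΦΨ : ∀ y, Φ (Ψ y) = y := by
    intro y; ext i
    rw [hΦ, hΨ, sub_add_cancel, ← mul_assoc, inv_mul_cancel₀ hTne, one_mul]
  have hder : ∀ x, HasFDerivAt Φ L x := fun x =>
    ((hasFDerivAt_id x).add_const v).const_smul (T : ℝ)⁻¹
  have hdet : L.det = ((T : ℝ)⁻¹) ^ d := by
    show LinearMap.det ((L : (Fin d → ℝ) →L[ℝ] (Fin d → ℝ)) : (Fin d → ℝ) →ₗ[ℝ] (Fin d → ℝ)) = _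
    have : ((L : (Fin d → ℝ) →L[ℝ] (Fin d → ℝ)) : (Fin d → ℝ) →ₗ[ℝ] (Fin d → ℝ)) =
        (T : ℝ)⁻¹ • LinearMap.id := by
      ext x i; simp [L]
    rw [this, LinearMap.det_smul, LinearMap.det_id, mul_one, Module.finrank_fin_fun]
  -- Step 2: the image `Φ(σ) = Ψ⁻¹(σ)` is `ℚ`-semialgebraic, inside the open box, of finite volume.
  set D : Set (Fin d → ℝ) := Ψ ⁻¹' A.domain with hD
  have hDeq : D = Φ '' A.domain := by
    ext y
    simp only [hD, mem_preimage, mem_image]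
    constructor
    · intro hy
      exact ⟨Ψ y, hy, hΦΨ y⟩
    · rintro ⟨x, hx, rfl⟩
      rwa [hΨΦ]
  have hDsa : IsSemialgebraic ℚ D := by
    have := A.isSemialgebraic_domain.preimage_aeval
      (fun j : Fin d => (MvPolynomial.C (T : ℚ) * MvPolynomial.X j - MvPolynomial.C (K : ℚ) :
        MvPolynomial (Fin d) ℚ))
    convert this using 1
    ext y
    simp only [hD, mem_preimage]
    congr! 1
    ext j
    simp [hΨ]
  have hDsub : D ⊆ {y | ∀ i, y i ∈ Set.Ioo (0:ℝ) 1} := by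
    intro y hy i
    have h := hcoord _ hy i
    rw [hΨ, hTK] at h
    constructor
    · nlinarith [h.1]
    · nlinarith [h.2]
  have hDvol : volume D < ⊤ := by
    refine (measure_mono (hDsub.trans ?_)).trans_lt
      ((Metric.isBounded_Icc (0 : Fin d → ℝ) 1).measure_lt_top)
    intro y hy
    exact ⟨fun i => (hy i).1.le, fun i => (hy i).2.le⟩
  -- Step 3: the target representation `B = [Φ(σ), Tᵈ]`.
  let B : IntegralRep d :=
    { domain := D
      integrand := fun _ => (T : ℝ) ^ d
      isSemialgebraic_domain := hDsa
      isSemialgebraicFunOn_integrand := by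
        simpa using isSemialgebraicFunOn_aeval hDsa (MvPolynomial.C ((T : ℚ) ^ d))
      integrableOn := integrableOn_const (hs := hDvol.ne) }
  -- Step 4: the single rule-(2) move.
  refine ⟨T, B, ?_, hDsub, rfl, ⟨d, A, B, Φ, fun _ => L, ?_, fun x _ => (hder x).hasFDerivWithinAt,
    ?_, hDeq, fun x hx => ?_, rfl⟩⟩
  · -- `1 ≤ T`
    have : (1 : ℝ) ≤ T := by rw [hTK]; linarith
    exact_mod_cast this
  · -- `Φ` is a polynomial map with rational coefficients on `σ`
    refine (isSemialgebraicMapOn_aeval A.isSemialgebraic_domain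
      (fun j : Fin d => (MvPolynomial.C ((T : ℚ)⁻¹) * (MvPolynomial.X j + MvPolynomial.C (K : ℚ)) :
        MvPolynomial (Fin d) ℚ))).congr fun x _ => ?_
    ext j
    simp [hΦ]
  · -- `Φ` is injective (it has the two-sided inverse `Ψ`)
    intro x _ y _ hxy
    rw [← hΨΦ x, ← hΨΦ y, hxy]
  · -- the Jacobian identity `1 = Tᵈ · |det (T⁻¹ • id)|`
    rw [h1 x hx, hdet, abs_of_pos (by positivity)]
    show (1 : ℝ) = (T : ℝ) ^ d * ((T : ℝ)⁻¹) ^ d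
    rw [← mul_pow, mul_inv_cancel₀ hTne, one_pow]

end UnitBoxSiegeK6

end Summit.KontsevichZagierPeriods.HurwitzMicroSectors.NormalFormPrinciple.PiBox
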